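import Summits.ResolutionOfSingularities.ResolutionOfSingularities.Theses.HomologicalConductor

/-!
# Disproof of `HomologicalConductor.Persistence` — findings (cdisprove cycle 1, 2026-08-17)

Crux (stmt-ResolutionOfSingularities-16484): along the canonical tower `T₀ = A_centre`,
`T_(m+1) = loc (nrm (chart T_m))` (chart = affine blow-up of the Iyengar–Takahashi cohomology
annihilator `ca(T_m)` at an element `x_m` of minimal `v`-value, `nrm` = normalisation in `K`,
`loc` = localisation at the centre of `v`), `ca(T_m) ⊆ ca(T_(m+1))` for every `m`.

**Verdict of this cycle: NO KILL.**  Nothing refutable was found; no negative lemma is honestly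
constructible in Lean (every candidate needs a non-vanishing `Ext` computation over a concrete
singular ring).  What the provers should take from this file:

1. *Encoding is faithful* (re-checked, `scratch/W.lean` rc 0): the `•` in the inline `ca` is
   `CategoryTheory.Abelian.Ext.instModule` coming from `ModuleCat.instLinear`, `HasExt.{0}` is
   `instHasExtModuleCatOfSmall`; the inline `ca B` is the image in `K` of
   `Literature.RingTheory.CohomologyAnnihilator.cohomologyAnnihilator ↥B`
   (`Subalgebra.image_coe_cohomologyAnnihilator`).  Degenerate slices (`K = k`; `O = K`; `T_m` regular;
   `dim A = 1`, where `T₁` is a DVR) all SATISFY the conclusion — no misstatement kill exists there.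
2. *Load-bearing hypotheses.*  `hk : ∀ c, algebraMap k K c ∈ O` is implied by `A ≤ O`
   (`hk_of_le` below); `p.Prime`/`CharP k p` are never used by the mechanism
   (`persistence_of_charFree` below: the characteristic-free statement implies the crux verbatim).
   `A.FG` + `IsFractionRing A K` are what make `ca(T_m) ≠ 0`, `V(ca) = Sing` and `nrm` finite; dropping
   them gives no cheap counterexample either (for Nagata-type rings `ca = 0` and the tower is constant).
3. *Key reduction* (route-review refuter, re-derived): since `ca(T_m)·T_(m+1) = x_m·T_(m+1)` and
   `ca(T_(m+1))` is an ideal of `T_(m+1)`, Persistence at step `m` ⟺ `x_m ∈ ca(T_(m+1))`.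
   The radical version is automatic (`Sing T_(m+1) ⊆ V(x_m)`), so the whole content is the
   EXPONENT: is the exceptional-divisor equation itself (not a power) a cohomology annihilator upstairs?
4. *Exact computation on the largest computable family — 2-dimensional toric (cyclic quotient)
   germs `T(d,a)`, all characteristics* (evidence `TORIC-SCAN.md`, code `toric/catower.py`):
   MCM `T`-modules are the `d` conic modules `M_j` (Herzog's argument, char-free);
   `End(M_j) = T`, stable `End(M_j) = T/(M_j·M_(-j))`; `Ω M_j ≅ ⊕ M_(j - label pᵢ)` over consecutive
   minimal generators; `ca(T) = ⋂_{j recurrent} M_j·M_(-j)` where "recurrent" = occurs in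
   arbitrarily high syzygies (Esentepe 2025, Remark 2.3(4): `ca = ann(Ωⁿ CM)` for `n ≫ 0`); the
   recurrent classes are exactly the duals of Wunram's special modules (Iyama–Wemyss `ΩCM = (SCM)*`,
   verified for all `d ≤ 80`); the normalised blow-up of the monomial ideal `ca(T)` is the normal fan of
   its Newton polygon, the chart at a vertex `v` is again some `T(d₁,a₁)` and Persistence there ⟺
   `χ^v ∈ ca(T₁)` ⟺ the box `[0,v]` (in `T₁`'s fine lattice) meets every recurrent class of `T₁`.
   RESULT: all `(d,a)` with `d ≤ 300` — 15 103 singular interior charts — ZERO failures; 331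
   near-misses in which the box misses only NON-recurrent classes (smallest: `T(60,11)`, vertex
   `(6,6)`, chart `T(12,5) = 1/12(1,7)`, box `[0,3]²` misses class 6, recurrent classes `{5,10,11}`).
   At boundary vertices Persistence is automatic (the segment `[0,e₁]` meets all `d₁` cosets).
   So on toric surface towers Persistence holds with margin EXACTLY the Iyama–Wemyss syzygy
   structure — a proof in general must see that structure (or an MCM-extending property); a
   "`x_m` is a big element" argument is false (the near-misses).
5. *Rational double points under the card's (unverified) values `ca(RDP) = R_(≥ h-1)`*:
   `Bl^norm_I(S^G) = Y/G` with `Y = Bl^norm_(IS)(S)`; for `\overline{IS} = \overline{(g) + 𝔪^(n+2)}`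
   (`g` of order `n` with `n` distinct tangents: `E_8`, `n = 30`; `D_4`, `n = 6`) the first exceptional
   curve `E'` and the thirty (six) `(-2)`-curves over the tangents have `D·C = 0` and are CONTRACTED —
   a purely local toric treatment at the tangent points is wrong.  Globally: `E_8 →` one point whose
   quotient resolution graph `Ē'(-3) + A_4 + A_2 + A_1 — F̄'(-1)` blows down to an `A_7` (this confirms the
   rattack refuter's "x-chart = A_7"); `D_4 → A_1` (confirms the card).  In both, `x₀ = x ∈ 𝔪_(T₀)T₁ ⊆ ca(T₁)`.
6. *Where a counterexample could still live*: (i) non-cyclic small `G ⊆ GL₂` (needs the stable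
   annihilator of higher-rank special modules); (ii) wild `z^p + F` surface points and non-toric
   sandwiched singularities (needs Singular/Macaulay2 — not on kit; sympy is on the compute nodes only);
   (iii) dimension ≥ 3 with non-isolated singular locus.  Recipe: one recurrent MCM `L` over `T₁` with
   `x₀ · \underline{End}(L) ≠ 0`.

No `sorry` in this file.  Nothing here asserts a Theses declaration positively except through an
explicitly stronger hypothesis (`persistence_of_charFree`).
-/

set_option linter.dupNamespace false

namespace Summit.ResolutionOfSingularities.ResolutionOfSingularities.Cruxes.Persistence.Disproof

open Summit.ResolutionOfSingularities.ResolutionOfSingularities.Theses.HomologicalConductor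

/-- Load-bearing analysis, hypothesis `hk`: `∀ c : k, algebraMap k K c ∈ O` is REDUNDANT — it follows
from `A.toSubring ≤ O.toSubring` because `algebraMap k K c ∈ A`.  (So no `_false_without_hk` can exist.) -/
theorem hk_of_le {k K : Type} [Field k] [Field K] [Algebra k K] (O : ValuationSubring K)
    (A : Subalgebra k K) (hAO : A.toSubring ≤ O.toSubring) : ∀ c : k, algebraMap k K c ∈ O :=
  fun c => hAO (A.algebraMap_mem c)

/-- The characteristic-free form of the crux: the same tower statement over ALL pairs of fields
`k ⊆ K` (no prime `p`, no `CharP`).  The mechanism (cohomology annihilator, blow-up, normalisation,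
localisation) never uses the characteristic; every computation in this file's docblock is
characteristic-free. -/
def PersistenceCharFree : Prop :=
  ∀ (k K : Type) [Field k] [Field K] [Algebra k K] (O : ValuationSubring K) (A : Subalgebra k K), (∀ c : k, algebraMap k K c ∈ O) → A.FG → IsFractionRing ↥A K → A.toSubring ≤ O.toSubring → let ca : Subalgebra k K → Set K := fun A => {x : K | ∃ hx : x ∈ A, ∃ n : ℕ, ∀ i : ℕ, n ≤ i → ∀ (M N : ModuleCat.{0} ↥A), Module.Finite ↥A M → Module.Finite ↥A N → ∀ e : CategoryTheory.Abelian.Ext.{0} M N i, (⟨x, hx⟩ : ↥A) • e = 0}; let loc : Subalgebra k K → Subalgebra k K := fun A => Algebra.adjoin k {y : K | ∃ a ∈ A, ∃ s ∈ A, s⁻¹ ∈ O ∧ y = a * s⁻¹}; let chart : Subalgebra k K → Subalgebra k K := fun A => Algebra.adjoin k ((A : Set K) ∪ {y : K | ∃ c ∈ ca A, ∃ x ∈ ca A, x ≠ 0 ∧ (∀ c' ∈ ca A, c' * x⁻¹ ∈ O) ∧ y = c * x⁻¹}); let nrm : Subalgebra k K → Subalgebra k K := fun B => Algebra.adjoin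 k {y : K | IsIntegral ↥B y}; let tower : Subalgebra k K → ℕ → Subalgebra k K := fun A m => @Nat.rec (fun _ => Subalgebra k K) (loc A) (fun _ B => loc (nrm (chart B))) m; ∀ m : ℕ, ca (tower A m) ⊆ ca (tower A (m + 1))

/-- Load-bearing analysis, hypotheses `p.Prime` / `CharP k p`: they are DECORATIVE — the
characteristic-free statement gives the crux verbatim (so a refutation of the crux would refute the
characteristic-free statement in characteristic `p`, and a proof should not expect to use `p`). -/
theorem persistence_of_charFree (h : PersistenceCharFree) : Persistence :=
  fun _ _ k K _ _ _ _ O A hk hFG hFrac hAO => h k K O A hk hFG hFrac hAO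

end Summit.ResolutionOfSingularities.ResolutionOfSingularities.Cruxes.Persistence.Disproof
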